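import Literature.MathematicalPhysics.QuantumFieldTheory.Balaban1983to89.T4ForestGaugeCorridorBound
import Literature.MathematicalPhysics.QuantumFieldTheory.Balaban1983to89.B15Prop1MinimiserTowerAxialGauge

/-!
# `Balaban1983to89.T4RootTransporterHubs` — [Balaban1985Variational] = «[15]», (16)–(18) p. 280 ∕ [Balaban1985Averaging] (19)–(20) p. 21: TRANSPORTER LETTERS COMPOSE AND
# REVERSE — the root-transporter letter of `B15Prop1InteriorLetterCorridor` for the two roots of a bond follows from HUB letters: every root joined to a hub of its site, and the
# hubs of adjacent sites joined to each other, each by a short fine word with near-trivial transport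

statement-level skeleton of published theorems with citation tags; proofs where landed; nothing here is a claim about the Yang–Mills mass gap

WHY (cell `pub-ymgap`, HUMAN RULINGS D-0062 ∕ D-0149 ∕ D-0154, width seat `pub-ymgap-dag-n12-w6` g2; node N12 = [B15]; lane word dag-n12-c g19 «hL-corridor: w6's», cell bus 2026-08-28).
`B15Prop1InteriorLetterCorridor` reduced the two-root half of the interior letter to a ROOT-TRANSPORTER LETTER: for every bond `b` inside `Ω₁(Z)` a fine word from `root b₋` to `root b₊`
of length `≤ ℓT` whose `U₀`-transport is `eT`-near a `dG`-near-`1` group element.  In the rooted tower forest of `𝐁_k(Z)` (dag-n12-w3's `…N12TowerForestRootsBj`, ★ (CENTRE)) the root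
of a site of `Γ`-level `J` is the centre of its `J`-block or — on the face layer of a boundary block — the centre of its `(J−1)`-block, and the natural way to join two roots is THROUGH HUBS:
`root b₋ ⇝ hub b₋ ⇝ hub b₊ ⇝ root b₊` (hub = the centre of the `Γ`-level block), each leg a chain of member-bond segments whose transports are pinned by the constrained averages
(`T4ForestGaugeCorridorBound` §1∕§3, dag-n12-w2's `BlockAveragingTowerStraightTransportLocal`).  THIS FILE is the algebra of that composition: transporter data `(Ω, g, ℓ, e, d)` —
`walkEnd a Ω = b`, `|Ω| ≤ ℓ`, `dist1 (𝒰_U(walk a Ω)·g⁻¹) ≤ e`, `dist1 g ≤ d` — REVERSE (`Ωᵒᵖ`, `g⁻¹`, same budgets) and APPEND (concatenate, multiply, add budgets), so three hub legs give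
the root-transporter datum with budgets `(2ℓ₁ + ℓ₂, 2e₁ + e₂, 2d₁ + d₂)`; §3 states the reduction of the letter itself.  The hub letters are inhabited from the chain geometry of `𝐁_k(Z)` in
the next (Summits-side) file of this lineage.

CONTENTS (theorems only; no `def`, no `instance`, no `sorry`).
* §1 ★ `transporter_reverse` (reverse word, inverse element, same budgets), ★ `transporter_append` (concatenation: budgets add), `transporter_nil` (the empty word at `g = 1`).
* §2 ★★ `rootTransporter_of_hubs` — three legs `r₁ ⇝ h₁`, `h₁ ⇝ h₂`, `r₂ ⇝ h₂` give `r₁ ⇝ r₂` with budgets `(ℓ₁ + ℓ₂ + ℓ₁', e₁ + e₂ + e₁', d₁ + d₂ + d₁')`.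
* §3 ★★★ `rootTransporterLetter_of_hubLetters` — on a site set `Ω` with maps `root`, `hub`: the HUB LETTERS (H1) «`root x ⇝ hub x` for every `x ∈ Ω` with budgets `(ℓ₁, e₁, d₁)`» and
  (H2) «`hub b₋ ⇝ hub b₊` for every bond inside `Ω` with budgets `(ℓ₂, e₂, d₂)`» give the ROOT-TRANSPORTER LETTER of `B15Prop1InteriorLetterCorridor.dist1_gaugeAct_holAtGauge_le_of_rootNe` ∕
  `interiorLetter_corridor_atRecord` with `(ℓT, eT, dG) := (2ℓ₁ + ℓ₂, 2e₁ + e₂, 2d₁ + d₂)` (the `root b₋ ≠ root b₊` premise is not even used).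

HONEST FRAMING: [folklore] group∕lattice bookkeeping (`dist1` is inverse- and conjugation-invariant and subadditive); no estimate of Bałaban's asserted; the hub letters stay DISPLAYED;
count-neutral; N12 NOT discharged; finite 𝕋⁴ at fixed ε; nothing continuum ∕ OS ∕ mass-gap ∕ Clay.
-/

noncomputable section

namespace Literature.MathematicalPhysics.QuantumFieldTheory.Balaban1983to89.T4RootTransporterHubs

open T4Continuum GaugeField
open B14.Eq213DetSet (maxDomT)
open T4ForestGaugeCorridorBound (dist1_holAt_append_mul_mul_inv_le)

variable {P : Params} {j : ℕ} {G : Type*} [GaugeGroup G]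

/-! ## §1  Transporter data reverse and compose -/

section Algebra

/-- The reversed word has the same length. [folklore] -/
private theorem length_wordRev (w : List (Letter P.d)) : (wordRev w).length = w.length := by
  simp only [wordRev, List.length_reverse, List.length_map]

/-- ★ **REVERSE**: a transporter datum from `a` to `b` — `walkEnd a Ω = b`, `dist1 (𝒰_U(walk a Ω)·g⁻¹) ≤ e` — gives one from `b` to `a` with the reversed word (same length), the
inverse element (same `dist1`) and the same budget: `𝒰(Ωᵒᵖ) = 𝒰(Ω)⁻¹` (`holAt_walk_wordRev`) and `|𝒰⁻¹g − 1| = |g⁻¹(𝒰g⁻¹)g − 1| = |𝒰g⁻¹ − 1|`. [cite: Balaban1985Averaging, (7)–(9) pp.18–19, (19)–(20) p.21] -/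
theorem transporter_reverse (U : GaugeField P j G) {a b : Site P j} {Ω : List (Letter P.d)} (hΩ : walkEnd a Ω = b) {g : G} {e : ℝ}
    (hH : dist1 (holAt U (walk a Ω) * g⁻¹) ≤ e) :
    walkEnd b (wordRev Ω) = a ∧ (wordRev Ω).length = Ω.length ∧ dist1 (holAt U (walk b (wordRev Ω)) * (g⁻¹)⁻¹) ≤ e ∧ dist1 g⁻¹ = dist1 g := by
  subst hΩ
  refine ⟨walkEnd_walkEnd_wordRev a Ω, length_wordRev Ω, ?_, GaugeGroup.dist1_inv g⟩
  rw [holAt_walk_wordRev, inv_inv]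
  have h1 : (holAt U (walk a Ω))⁻¹ * g = (g⁻¹ * holAt U (walk a Ω))⁻¹ := by rw [mul_inv_rev, inv_inv]
  have h2 : g⁻¹ * holAt U (walk a Ω) = g⁻¹ * (holAt U (walk a Ω) * g⁻¹) * g⁻¹⁻¹ := by rw [inv_inv, mul_assoc, inv_mul_cancel_right]
  rw [h1, GaugeGroup.dist1_inv, h2, GaugeGroup.dist1_conj]
  exact hH

/-- ★ **APPEND**: transporter data `a ⇝ b` (`Ω₁, g₁, e₁`) and `b ⇝ c` (`Ω₂, g₂, e₂`) give `a ⇝ c` with the concatenated word (lengths add), the product element and the sum of the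
budgets (`T4ForestGaugeCorridorBound.dist1_holAt_append_mul_mul_inv_le`); and `dist1 (g₁g₂) ≤ dist1 g₁ + dist1 g₂`. [cite: Balaban1985Averaging, (19)–(20) p.21] -/
theorem transporter_append (U : GaugeField P j G) {a b c : Site P j} {Ω₁ Ω₂ : List (Letter P.d)} (h₁ : walkEnd a Ω₁ = b) (h₂ : walkEnd b Ω₂ = c)
    {g₁ g₂ : G} {e₁ e₂ : ℝ} (hH₁ : dist1 (holAt U (walk a Ω₁) * g₁⁻¹) ≤ e₁) (hH₂ : dist1 (holAt U (walk b Ω₂) * g₂⁻¹) ≤ e₂) :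
    walkEnd a (Ω₁ ++ Ω₂) = c ∧ (Ω₁ ++ Ω₂).length = Ω₁.length + Ω₂.length ∧
      dist1 (holAt U (walk a (Ω₁ ++ Ω₂)) * (g₁ * g₂)⁻¹) ≤ e₁ + e₂ ∧ dist1 (g₁ * g₂) ≤ dist1 g₁ + dist1 g₂ := by
  refine ⟨by rw [walkEnd_append, h₁, h₂], List.length_append, ?_, GaugeGroup.dist1_mul_le g₁ g₂⟩
  have h := dist1_holAt_append_mul_mul_inv_le U a Ω₁ Ω₂ g₁ g₂
  rw [h₁] at h
  exact h.trans (add_le_add hH₁ hH₂)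

/-- The empty word is a transporter datum from a site to itself at `g = 1` with zero budgets (the trivial parallel transport). [cite: Balaban1985Averaging, (7)–(9) pp.18–19 (bookkeeping)] -/
theorem transporter_nil (U : GaugeField P j G) (a : Site P j) :
    walkEnd a ([] : List (Letter P.d)) = a ∧ ([] : List (Letter P.d)).length = 0 ∧ dist1 (holAt U (walk a ([] : List (Letter P.d))) * (1 : G)⁻¹) ≤ 0 ∧ dist1 (1 : G) ≤ 0 := by
  refine ⟨rfl, rfl, ?_, (GaugeGroup.dist1_one (G := G)).le⟩
  simp [walk, holAt_nil, GaugeGroup.dist1_one]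

end Algebra

/-! ## §2  Three hub legs give the root-transporter datum -/

section Hubs

/-- ★★ **ROOT TO ROOT THROUGH THE HUBS**: legs `r₁ ⇝ h₁` (budgets `ℓ₁, e₁, d₁`), `h₁ ⇝ h₂` (`ℓ₂, e₂, d₂`) and `r₂ ⇝ h₂` (`ℓ₁', e₁', d₁'`; reversed inside) give a transporter datum
`r₁ ⇝ r₂`: a word of length `≤ ℓ₁ + ℓ₂ + ℓ₁'`, an element `g` with `dist1 (𝒰(Ω)·g⁻¹) ≤ e₁ + e₂ + e₁'` and `dist1 g ≤ d₁ + d₂ + d₁'`.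
[cite: Balaban1985Variational, (16)–(18) p.280; Balaban1985Averaging, (19)–(20) p.21] -/
theorem rootTransporter_of_hubs (U : GaugeField P j G) {r₁ h₁ h₂ r₂ : Site P j}
    {Ω₁ Ω₂ Ω₃ : List (Letter P.d)} {g₁ g₂ g₃ : G} {ℓ₁ ℓ₂ ℓ₁' : ℕ} {e₁ e₂ e₁' d₁ d₂ d₁' : ℝ}
    (hw₁ : walkEnd r₁ Ω₁ = h₁) (hl₁ : Ω₁.length ≤ ℓ₁) (hH₁ : dist1 (holAt U (walk r₁ Ω₁) * g₁⁻¹) ≤ e₁) (hd₁ : dist1 g₁ ≤ d₁)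
    (hw₂ : walkEnd h₁ Ω₂ = h₂) (hl₂ : Ω₂.length ≤ ℓ₂) (hH₂ : dist1 (holAt U (walk h₁ Ω₂) * g₂⁻¹) ≤ e₂) (hd₂ : dist1 g₂ ≤ d₂)
    (hw₃ : walkEnd r₂ Ω₃ = h₂) (hl₃ : Ω₃.length ≤ ℓ₁') (hH₃ : dist1 (holAt U (walk r₂ Ω₃) * g₃⁻¹) ≤ e₁') (hd₃ : dist1 g₃ ≤ d₁') :
    ∃ (Ω : List (Letter P.d)) (g : G), walkEnd r₁ Ω = r₂ ∧ Ω.length ≤ ℓ₁ + ℓ₂ + ℓ₁' ∧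
      dist1 (holAt U (walk r₁ Ω) * g⁻¹) ≤ e₁ + e₂ + e₁' ∧ dist1 g ≤ d₁ + d₂ + d₁' := by
  obtain ⟨hw₃', hl₃', hH₃', hd₃'⟩ := transporter_reverse U hw₃ hH₃
  obtain ⟨hw₁₂, hl₁₂, hH₁₂, hd₁₂⟩ := transporter_append U hw₁ hw₂ hH₁ hH₂
  obtain ⟨hw, hl, hH, hd⟩ := transporter_append U hw₁₂ hw₃' hH₁₂ hH₃'
  refine ⟨(Ω₁ ++ Ω₂) ++ wordRev Ω₃, g₁ * g₂ * g₃⁻¹, hw, ?_, hH, ?_⟩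
  · rw [hl, hl₁₂, hl₃']; omega
  · calc dist1 (g₁ * g₂ * g₃⁻¹) ≤ dist1 (g₁ * g₂) + dist1 g₃⁻¹ := hd
      _ ≤ dist1 g₁ + dist1 g₂ + dist1 g₃ := by rw [hd₃']; linarith
      _ ≤ d₁ + d₂ + d₁' := by linarith

end Hubs

/-! ## §3  The root-transporter letter from hub letters -/

section Letter

/-- ★★★ **THE ROOT-TRANSPORTER LETTER FROM HUB LETTERS** (any site set `Ω`, maps `root`, `hub`): if (H1) every site `x ∈ Ω` has a transporter datum `root x ⇝ hub x` with budgets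
`(ℓ₁, e₁, d₁)` and (H2) every bond `b` with both ends in `Ω` has one `hub b₋ ⇝ hub b₊` with budgets `(ℓ₂, e₂, d₂)`, then every such bond has a transporter datum `root b₋ ⇝ root b₊` with
budgets `(2ℓ₁ + ℓ₂, 2e₁ + e₂, 2d₁ + d₂)` — the premise `hT` of `B15Prop1InteriorLetterCorridor.dist1_gaugeAct_holAtGauge_le_of_rootNe` ∕ `interiorLetter_corridor_atRecord` at
`Ω = Ω₁(Z) = maxDomT ν.M₁ Z 1` (its `root b₋ ≠ root b₊` premise is simply dropped).  In the tower forest of `𝐁_k(Z)` the hub of a site is the centre of its `Γ`-level block and (H1),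
(H2) are chains of member-bond segments (the next, Summits-side file of this lineage). [cite: Balaban1985Variational, (16)–(18) p.280; Balaban1985RegularSpaces, (1.19) p.79; Balaban1985Averaging, (19)–(20) p.21] -/
theorem rootTransporterLetter_of_hubLetters (U : GaugeField P j G) (Ω : Set (Site P j)) (root hub : Site P j → Site P j)
    {ℓ₁ ℓ₂ : ℕ} {e₁ e₂ d₁ d₂ : ℝ}
    (hH1 : ∀ x ∈ Ω, ∃ (Ωw : List (Letter P.d)) (g : G), walkEnd (root x) Ωw = hub x ∧ Ωw.length ≤ ℓ₁ ∧
      dist1 (holAt U (walk (root x) Ωw) * g⁻¹) ≤ e₁ ∧ dist1 g ≤ d₁)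
    (hH2 : ∀ b : PBond P j, b.src ∈ Ω → b.tgt ∈ Ω → ∃ (Ωw : List (Letter P.d)) (g : G), walkEnd (hub b.src) Ωw = hub b.tgt ∧ Ωw.length ≤ ℓ₂ ∧
      dist1 (holAt U (walk (hub b.src) Ωw) * g⁻¹) ≤ e₂ ∧ dist1 g ≤ d₂) :
    ∀ b : PBond P j, b.src ∈ Ω → b.tgt ∈ Ω → root b.src ≠ root b.tgt →
      ∃ (Ωw : List (Letter P.d)) (g : G), walkEnd (root b.src) Ωw = root b.tgt ∧ Ωw.length ≤ 2 * ℓ₁ + ℓ₂ ∧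
        dist1 (holAt U (walk (root b.src) Ωw) * g⁻¹) ≤ 2 * e₁ + e₂ ∧ dist1 g ≤ 2 * d₁ + d₂ := by
  intro b hbs hbt _
  obtain ⟨Ω₁, g₁, hw₁, hl₁, hH₁, hd₁⟩ := hH1 b.src hbs
  obtain ⟨Ω₂, g₂, hw₂, hl₂, hH₂, hd₂⟩ := hH2 b hbs hbt
  obtain ⟨Ω₃, g₃, hw₃, hl₃, hH₃, hd₃⟩ := hH1 b.tgt hbt
  obtain ⟨Ωw, g, hw, hl, hH, hd⟩ := rootTransporter_of_hubs U hw₁ hl₁ hH₁ hd₁ hw₂ hl₂ hH₂ hd₂ hw₃ hl₃ hH₃ hd₃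
  exact ⟨Ωw, g, hw, by omega, by linarith, by linarith⟩

end Letter

end Literature.MathematicalPhysics.QuantumFieldTheory.Balaban1983to89.T4RootTransporterHubs

end
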